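import Literature.Probability.RandomPlanarGeometry.HalfPlaneMoebius
import Literature.Probability.RandomPlanarGeometry.ConformalRectangle
import HarnessLib

/-!
# The Möbius matching of two marked real quadruples with equal cross-ratio

Topic `Literature/Probability/RandomPlanarGeometry`. **Four points with the same cross-ratio
are related by a linear transformation** (Ahlfors, *Complex Analysis* (1979), Ch. 3 §3), in the
form needed to compose two uniformizing data `(φ_S, ξ)`, `(φ_R, y)` of conformal rectangles with
the same Cardy cross-ratio into a conformal map `φ_R ∘ M ∘ φ_S⁻¹` *with side correspondence*
(`exists_moebius_match`): two strictly monotone-or-antitone real quadruples `ξ`, `y` with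
`crossRatio ξ = crossRatio y` are related by a real Möbius map `M t = (a t + b)/(c t + d)`,
`a d - b c > 0`, carrying the closed interval between `ξ₀, ξ₁` into the one between `y₀, y₁`
and the interval between `ξ₂, ξ₃` into the one between `y₂, y₃`, the pole lying off both
intervals, and the inverse map `(d u - b)/(-c u + a)` doing the same backwards. When `ξ` and
`y` have the same orientation type the map sends `ξᵢ ↦ yᵢ`; otherwise (a holomorphic map cannot
reverse the boundary orientation) it sends `ξ₀ ↦ y₁, ξ₁ ↦ y₀, ξ₂ ↦ y₃, ξ₃ ↦ y₂` — the
cross-ratio is invariant under this relabelling and the relabelled quadruple has the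
orientation type of `ξ`. The map is written down explicitly as `T_y⁻¹ ∘ T_ξ` with
`T_x : x₁ ↦ 0, x₂ ↦ ∞, x₃ ↦ 1` (so that `T_x x₀ = crossRatio x`), its four coefficients being
polynomials in the eight points; all identities are `ring` computations
(`exists_moebius_match_aux`), and the interval statements follow from the monotonicity of the
real trace (`moebius_intervals_of_match`, from `HalfPlaneMoebius.lean`). Everything is PROVED;
no definition is introduced.

## References

* L. V. Ahlfors, *Complex Analysis*, 3rd ed. (1979), Ch. 3 §3. [AhlforsCA1979]
-/

noncomputable section

open Set

namespace Literature.Probability.RandomPlanarGeometry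

section Matching

variable {a b c d : ℝ}

/-- **Explicit Möbius matching.** For real quadruples `ξ`, `y` satisfying the (denominator-free)
cross-ratio identity, the orientation condition `hor` and the four "not between" sign
conditions, the real Möbius map `T_y⁻¹ ∘ T_ξ` (with `T_x : x₁ ↦ 0, x₂ ↦ ∞, x₃ ↦ 1`, so that
`T_x x₀` is the cross-ratio) has positive determinant, sends `ξᵢ ↦ yᵢ` for all four `i`, and its
pole separates neither `ξ₀` from `ξ₁` nor `ξ₂` from `ξ₃`. Its coefficients are written out as
polynomials; every identity is a `ring` computation (the value at `ξ₀` uses the cross-ratio). [folklore] -/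
theorem exists_moebius_match_aux (ξ y : Fin 4 → ℝ)
    (hcr : (ξ 0 - ξ 1) * (ξ 2 - ξ 3) * ((y 0 - y 2) * (y 1 - y 3)) =
      (y 0 - y 1) * (y 2 - y 3) * ((ξ 0 - ξ 2) * (ξ 1 - ξ 3)))
    (hor : 0 < (ξ 2 - ξ 3) * (ξ 1 - ξ 3) * (ξ 1 - ξ 2) *
      ((y 2 - y 3) * (y 1 - y 3) * (y 1 - y 2)))
    (hξ2 : 0 < (ξ 0 - ξ 2) * (ξ 1 - ξ 2)) (hy2 : 0 < (y 1 - y 2) * (y 0 - y 2))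
    (hξ1 : 0 < (ξ 2 - ξ 1) * (ξ 3 - ξ 1)) (hy1 : 0 < (y 1 - y 3) * (y 1 - y 2)) :
    ∃ a b c d : ℝ, 0 < a * d - b * c ∧
      (∀ i, c * ξ i + d ≠ 0 ∧ (a * ξ i + b) / (c * ξ i + d) = y i) ∧
      0 < (c * ξ 0 + d) * (c * ξ 1 + d) ∧ 0 < (c * ξ 2 + d) * (c * ξ 3 + d) := by
  set A := y 2 * (y 1 - y 3) * (ξ 2 - ξ 3) - y 1 * (y 2 - y 3) * (ξ 1 - ξ 3) with hA
  set B := -(y 2 * (y 1 - y 3) * ξ 1 * (ξ 2 - ξ 3)) + y 1 * (y 2 - y 3) * ξ 2 * (ξ 1 - ξ 3)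
    with hB
  set C := (y 1 - y 3) * (ξ 2 - ξ 3) - (y 2 - y 3) * (ξ 1 - ξ 3) with hC
  set D := -((y 1 - y 3) * ξ 1 * (ξ 2 - ξ 3)) + (y 2 - y 3) * ξ 2 * (ξ 1 - ξ 3) with hD
  -- the algebraic identities
  have hdet : A * D - B * C =
      (ξ 2 - ξ 3) * (ξ 1 - ξ 3) * (ξ 1 - ξ 2) * ((y 2 - y 3) * (y 1 - y 3) * (y 1 - y 2)) := by
    simp only [hA, hB, hC, hD]; ring
  have hd1 : C * ξ 1 + D = -((y 2 - y 3) * (ξ 1 - ξ 2) * (ξ 1 - ξ 3)) := by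
    simp only [hC, hD]; ring
  have hd2 : C * ξ 2 + D = (y 1 - y 3) * (ξ 2 - ξ 1) * (ξ 2 - ξ 3) := by
    simp only [hC, hD]; ring
  have hd3 : C * ξ 3 + D = (ξ 3 - ξ 1) * (ξ 2 - ξ 3) * (y 1 - y 2) := by
    simp only [hC, hD]; ring
  have hn1 : A * ξ 1 + B = y 1 * (C * ξ 1 + D) := by simp only [hA, hB, hC, hD]; ring
  have hn2 : A * ξ 2 + B = y 2 * (C * ξ 2 + D) := by simp only [hA, hB, hC, hD]; ring
  have hn3 : A * ξ 3 + B = y 3 * (C * ξ 3 + D) := by simp only [hA, hB, hC, hD]; ring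
  have hd0 : (C * ξ 0 + D) * ((y 0 - y 2) * (y 1 - y 3)) =
      (ξ 0 - ξ 2) * (ξ 1 - ξ 3) * (y 1 - y 3) * (y 2 - y 3) * (y 2 - y 1) := by
    have h : (C * ξ 0 + D) * ((y 0 - y 2) * (y 1 - y 3)) =
        (ξ 0 - ξ 2) * (ξ 1 - ξ 3) * (y 1 - y 3) * (y 2 - y 3) * (y 2 - y 1) +
          (y 1 - y 3) * ((ξ 0 - ξ 1) * (ξ 2 - ξ 3) * ((y 0 - y 2) * (y 1 - y 3)) -
            (y 0 - y 1) * (y 2 - y 3) * ((ξ 0 - ξ 2) * (ξ 1 - ξ 3))) := by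
      simp only [hC, hD]; ring
    rw [h, hcr, sub_self, mul_zero, add_zero]
  have hn0 : A * ξ 0 + B = y 0 * (C * ξ 0 + D) := by
    have h : A * ξ 0 + B - y 0 * (C * ξ 0 + D) =
        -((ξ 0 - ξ 1) * (ξ 2 - ξ 3) * ((y 0 - y 2) * (y 1 - y 3)) -
          (y 0 - y 1) * (y 2 - y 3) * ((ξ 0 - ξ 2) * (ξ 1 - ξ 3))) := by
      simp only [hA, hB, hC, hD]; ring
    rw [hcr, sub_self, neg_zero, sub_eq_zero] at h
    exact h
  -- non-vanishing factors
  have hy02 : y 0 - y 2 ≠ 0 := right_ne_zero_of_mul hy2.ne'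
  have hy13 : y 1 - y 3 ≠ 0 := left_ne_zero_of_mul hy1.ne'
  have hsq : 0 < ((y 0 - y 2) * (y 1 - y 3)) ^ 2 := by
    have := mul_ne_zero hy02 hy13
    positivity
  have hS1 : (ξ 1 - ξ 3) * (y 1 - y 3) * (y 2 - y 3) ≠ 0 := by
    refine mul_ne_zero (mul_ne_zero ?_ hy13) ?_
    · intro h; rw [h] at hor; simp at hor
    · intro h; rw [h] at hor; simp at hor
  have hS2 : ξ 2 - ξ 3 ≠ 0 := by intro h; rw [h] at hor; simp at hor
  -- the signs of the denominators
  have s01 : 0 < (C * ξ 0 + D) * (C * ξ 1 + D) := by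
    have h : (C * ξ 0 + D) * (C * ξ 1 + D) * ((y 0 - y 2) * (y 1 - y 3)) ^ 2 =
        ((ξ 1 - ξ 3) * (y 1 - y 3) * (y 2 - y 3)) ^ 2 * ((ξ 0 - ξ 2) * (ξ 1 - ξ 2)) *
          ((y 1 - y 2) * (y 0 - y 2)) := by
      rw [show (C * ξ 0 + D) * (C * ξ 1 + D) * ((y 0 - y 2) * (y 1 - y 3)) ^ 2 =
        (C * ξ 0 + D) * ((y 0 - y 2) * (y 1 - y 3)) * (C * ξ 1 + D) *
          ((y 0 - y 2) * (y 1 - y 3)) by ring, hd0, hd1]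
      ring
    have hpos : 0 < ((ξ 1 - ξ 3) * (y 1 - y 3) * (y 2 - y 3)) ^ 2 * ((ξ 0 - ξ 2) * (ξ 1 - ξ 2)) *
        ((y 1 - y 2) * (y 0 - y 2)) :=
      mul_pos (mul_pos (by positivity) hξ2) hy2
    rw [← h] at hpos
    exact (mul_pos_iff_of_pos_right hsq).1 hpos
  have s23 : 0 < (C * ξ 2 + D) * (C * ξ 3 + D) := by
    have h : (C * ξ 2 + D) * (C * ξ 3 + D) =
        (ξ 2 - ξ 3) ^ 2 * ((ξ 2 - ξ 1) * (ξ 3 - ξ 1)) * ((y 1 - y 3) * (y 1 - y 2)) := by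
      rw [hd2, hd3]; ring
    rw [h]
    exact mul_pos (mul_pos (by positivity) hξ1) hy1
  refine ⟨A, B, C, D, by rw [hdet]; exact hor, fun i => ?_, s01, s23⟩
  fin_cases i
  · exact ⟨left_ne_zero_of_mul s01.ne', (div_eq_iff (left_ne_zero_of_mul s01.ne')).2 hn0⟩
  · exact ⟨right_ne_zero_of_mul s01.ne', (div_eq_iff (right_ne_zero_of_mul s01.ne')).2 hn1⟩
  · exact ⟨left_ne_zero_of_mul s23.ne', (div_eq_iff (left_ne_zero_of_mul s23.ne')).2 hn2⟩
  · exact ⟨right_ne_zero_of_mul s23.ne', (div_eq_iff (right_ne_zero_of_mul s23.ne')).2 hn3⟩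

/-- From a pointwise matching `ξᵢ ↦ yᵢ` by a Möbius map with positive determinant whose pole
separates neither `ξ₀, ξ₁` nor `ξ₂, ξ₃`: the map carries the closed interval `[ξ₀, ξ₁]` into
`[y₀, y₁]` and `[ξ₂, ξ₃]` into `[y₂, y₃]` off its pole, and the inverse map `(d u - b)/(-c u + a)`
carries `[y₀, y₁]` into `[ξ₀, ξ₁]` and `[y₂, y₃]` into `[ξ₂, ξ₃]` off its pole. [folklore] -/
theorem moebius_intervals_of_match {ξ y : Fin 4 → ℝ} (hdet : 0 < a * d - b * c)
    (hval : ∀ i, c * ξ i + d ≠ 0 ∧ (a * ξ i + b) / (c * ξ i + d) = y i)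
    (s01 : 0 < (c * ξ 0 + d) * (c * ξ 1 + d)) (s23 : 0 < (c * ξ 2 + d) * (c * ξ 3 + d)) :
    (∀ t ∈ uIcc (ξ 0) (ξ 1), c * t + d ≠ 0 ∧ (a * t + b) / (c * t + d) ∈ uIcc (y 0) (y 1)) ∧
    (∀ t ∈ uIcc (ξ 2) (ξ 3), c * t + d ≠ 0 ∧ (a * t + b) / (c * t + d) ∈ uIcc (y 2) (y 3)) ∧
    (∀ u ∈ uIcc (y 0) (y 1), -c * u + a ≠ 0 ∧
        (d * u + -b) / (-c * u + a) ∈ uIcc (ξ 0) (ξ 1)) ∧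
    (∀ u ∈ uIcc (y 2) (y 3), -c * u + a ≠ 0 ∧
        (d * u + -b) / (-c * u + a) ∈ uIcc (ξ 2) (ξ 3)) := by
  have hdet' : 0 < d * a - -b * -c := by linarith
  have fwd : ∀ {i j : Fin 4} {t : ℝ}, 0 < (c * ξ i + d) * (c * ξ j + d) → t ∈ uIcc (ξ i) (ξ j) →
      c * t + d ≠ 0 ∧ (a * t + b) / (c * t + d) ∈ uIcc (y i) (y j) := by
    intro i j t hs ht
    obtain ⟨h1, h2⟩ := moebius_real_mem_uIcc hdet hs ht
    rw [(hval i).2, (hval j).2] at h2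
    exact ⟨right_ne_zero_of_mul h1.ne', h2⟩
  have hsd : ∀ k, -c * y k + a = (a * d - b * c) / (c * ξ k + d) := fun k => by
    rw [← (hval k).2]
    exact moebius_real_symm_den (hval k).1
  have hli : ∀ k, (d * y k + -b) / (-c * y k + a) = ξ k := fun k => by
    rw [← (hval k).2]
    exact moebius_real_leftInv hdet.ne' (hval k).1
  have bwd : ∀ {i j : Fin 4} {u : ℝ}, 0 < (c * ξ i + d) * (c * ξ j + d) → u ∈ uIcc (y i) (y j) →
      -c * u + a ≠ 0 ∧ (d * u + -b) / (-c * u + a) ∈ uIcc (ξ i) (ξ j) := by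
    intro i j u hs hu
    have hs' : 0 < (-c * y i + a) * (-c * y j + a) := by
      rw [hsd i, hsd j, div_mul_div_comm]
      exact div_pos (mul_pos hdet hdet) hs
    obtain ⟨h1, h2⟩ := moebius_real_mem_uIcc (a := d) (b := -b) (c := -c) (d := a) hdet' hs' hu
    rw [hli i, hli j] at h2
    exact ⟨right_ne_zero_of_mul h1.ne', h2⟩
  exact ⟨fun t ht => fwd s01 ht, fun t ht => fwd s23 ht, fun u hu => bwd s01 hu,
    fun u hu => bwd s23 hu⟩

/-- **Möbius matching of two uniformizing quadruples** (Ahlfors (1979), Ch. 3 §3: the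
cross-ratio is the only invariant of four points under linear transformations). Two strictly
monotone-or-antitone real quadruples `ξ`, `y` with the same Cardy cross-ratio are related by a
real Möbius map `(a t + b)/(c t + d)`, `a d - b c > 0`, carrying the closed interval between
`ξ₀, ξ₁` into that between `y₀, y₁` and the one between `ξ₂, ξ₃` into that between `y₂, y₃`,
off its pole, the inverse map `(d u - b)/(-c u + a)` doing the same backwards (same orientation
type: `ξᵢ ↦ yᵢ`; opposite types: `ξ₀ ↦ y₁, ξ₁ ↦ y₀, ξ₂ ↦ y₃, ξ₃ ↦ y₂`). [cite: AhlforsCA1979, Ch. 3 §3] -/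
theorem exists_moebius_match (ξ y : Fin 4 → ℝ) (hξ : StrictMono ξ ∨ StrictAnti ξ)
    (hy : StrictMono y ∨ StrictAnti y)
    (hcr : crossRatio ξ = crossRatio y) :
    ∃ a b c d : ℝ, 0 < a * d - b * c ∧
      (∀ t ∈ uIcc (ξ 0) (ξ 1), c * t + d ≠ 0 ∧ (a * t + b) / (c * t + d) ∈ uIcc (y 0) (y 1)) ∧
      (∀ t ∈ uIcc (ξ 2) (ξ 3), c * t + d ≠ 0 ∧ (a * t + b) / (c * t + d) ∈ uIcc (y 2) (y 3)) ∧
      (∀ u ∈ uIcc (y 0) (y 1), -c * u + a ≠ 0 ∧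
          (d * u + -b) / (-c * u + a) ∈ uIcc (ξ 0) (ξ 1)) ∧
      (∀ u ∈ uIcc (y 2) (y 3), -c * u + a ≠ 0 ∧
          (d * u + -b) / (-c * u + a) ∈ uIcc (ξ 2) (ξ 3)) := by
  have i01 : (0 : Fin 4) < 1 := by decide
  have i12 : (1 : Fin 4) < 2 := by decide
  have i23 : (2 : Fin 4) < 3 := by decide
  have hiξ : Function.Injective ξ := hξ.elim StrictMono.injective StrictAnti.injective
  have hiy : Function.Injective y := hy.elim StrictMono.injective StrictAnti.injective
  have hQ : (ξ 0 - ξ 2) * (ξ 1 - ξ 3) ≠ 0 :=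
    mul_ne_zero (sub_ne_zero.2 (hiξ.ne (by decide))) (sub_ne_zero.2 (hiξ.ne (by decide)))
  have hQ' : (y 0 - y 2) * (y 1 - y 3) ≠ 0 :=
    mul_ne_zero (sub_ne_zero.2 (hiy.ne (by decide))) (sub_ne_zero.2 (hiy.ne (by decide)))
  have hPQ : (ξ 0 - ξ 1) * (ξ 2 - ξ 3) * ((y 0 - y 2) * (y 1 - y 3)) =
      (y 0 - y 1) * (y 2 - y 3) * ((ξ 0 - ξ 2) * (ξ 1 - ξ 3)) := by
    simp only [crossRatio] at hcr
    rwa [div_eq_div_iff hQ hQ'] at hcr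
  -- the relabelled target `(y 1, y 0, y 3, y 2)` has the same cross-ratio
  have hPQ' : (ξ 0 - ξ 1) * (ξ 2 - ξ 3) *
      ((![y 1, y 0, y 3, y 2] 0 - ![y 1, y 0, y 3, y 2] 2) *
        (![y 1, y 0, y 3, y 2] 1 - ![y 1, y 0, y 3, y 2] 3)) =
      (![y 1, y 0, y 3, y 2] 0 - ![y 1, y 0, y 3, y 2] 1) *
        (![y 1, y 0, y 3, y 2] 2 - ![y 1, y 0, y 3, y 2] 3) * ((ξ 0 - ξ 2) * (ξ 1 - ξ 3)) := by
    simp only [Matrix.cons_val]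
    linear_combination hPQ
  -- conclusion from an explicit matching with the relabelled target
  have swap : (∃ a b c d : ℝ, 0 < a * d - b * c ∧
      (∀ i, c * ξ i + d ≠ 0 ∧ (a * ξ i + b) / (c * ξ i + d) = ![y 1, y 0, y 3, y 2] i) ∧
      0 < (c * ξ 0 + d) * (c * ξ 1 + d) ∧ 0 < (c * ξ 2 + d) * (c * ξ 3 + d)) →
      ∃ a b c d : ℝ, 0 < a * d - b * c ∧
      (∀ t ∈ uIcc (ξ 0) (ξ 1), c * t + d ≠ 0 ∧ (a * t + b) / (c * t + d) ∈ uIcc (y 0) (y 1)) ∧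
      (∀ t ∈ uIcc (ξ 2) (ξ 3), c * t + d ≠ 0 ∧ (a * t + b) / (c * t + d) ∈ uIcc (y 2) (y 3)) ∧
      (∀ u ∈ uIcc (y 0) (y 1), -c * u + a ≠ 0 ∧
          (d * u + -b) / (-c * u + a) ∈ uIcc (ξ 0) (ξ 1)) ∧
      (∀ u ∈ uIcc (y 2) (y 3), -c * u + a ≠ 0 ∧
          (d * u + -b) / (-c * u + a) ∈ uIcc (ξ 2) (ξ 3)) := by
    rintro ⟨a, b, c, d, hdet, hval, s01, s23⟩
    have h := moebius_intervals_of_match hdet hval s01 s23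
    simp only [Matrix.cons_val] at h
    rw [uIcc_comm (y 1), uIcc_comm (y 3)] at h
    exact ⟨a, b, c, d, hdet, h⟩
  rcases hξ with hξ | hξ <;> rcases hy with hy | hy
  · -- both increasing: `ξ i ↦ y i`
    have x01 := hξ i01; have x12 := hξ i12; have x23 := hξ i23
    have y01 := hy i01; have y12 := hy i12; have y23 := hy i23
    obtain ⟨a, b, c, d, hdet, hval, s01, s23⟩ := exists_moebius_match_aux ξ y hPQ
      (mul_pos_of_neg_of_neg
        (mul_neg_of_pos_of_neg (mul_pos_of_neg_of_neg (by linarith) (by linarith)) (by linarith))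
        (mul_neg_of_pos_of_neg (mul_pos_of_neg_of_neg (by linarith) (by linarith)) (by linarith)))
      (mul_pos_of_neg_of_neg (by linarith) (by linarith)) (mul_pos_of_neg_of_neg (by linarith) (by linarith))
      (mul_pos (by linarith) (by linarith)) (mul_pos_of_neg_of_neg (by linarith) (by linarith))
    exact ⟨a, b, c, d, hdet, moebius_intervals_of_match hdet hval s01 s23⟩
  · -- `ξ` increasing, `y` decreasing: relabel the target
    have x01 := hξ i01; have x12 := hξ i12; have x23 := hξ i23
    have y01 := hy i01; have y12 := hy i12; have y23 := hy i23
    refine swap (exists_moebius_match_aux ξ _ hPQ' ?_ ?_ ?_ ?_ ?_) <;>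
      (try simp only [Matrix.cons_val])
    · exact mul_pos_of_neg_of_neg
        (mul_neg_of_pos_of_neg (mul_pos_of_neg_of_neg (by linarith) (by linarith)) (by linarith))
        (mul_neg_of_neg_of_pos (mul_neg_of_neg_of_pos (by linarith) (by linarith)) (by linarith))
    · exact mul_pos_of_neg_of_neg (by linarith) (by linarith)
    · exact mul_pos (by linarith) (by linarith)
    · exact mul_pos (by linarith) (by linarith)
    · exact mul_pos (by linarith) (by linarith)
  · -- `ξ` decreasing, `y` increasing: relabel the target
    have x01 := hξ i01; have x12 := hξ i12; have x23 := hξ i23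
    have y01 := hy i01; have y12 := hy i12; have y23 := hy i23
    refine swap (exists_moebius_match_aux ξ _ hPQ' ?_ ?_ ?_ ?_ ?_) <;>
      (try simp only [Matrix.cons_val])
    · exact mul_pos (mul_pos (mul_pos (by linarith) (by linarith)) (by linarith))
        (mul_pos_of_neg_of_neg (mul_neg_of_pos_of_neg (by linarith) (by linarith)) (by linarith))
    · exact mul_pos (by linarith) (by linarith)
    · exact mul_pos_of_neg_of_neg (by linarith) (by linarith)
    · exact mul_pos_of_neg_of_neg (by linarith) (by linarith)
    · exact mul_pos_of_neg_of_neg (by linarith) (by linarith)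
  · -- both decreasing: `ξ i ↦ y i`
    have x01 := hξ i01; have x12 := hξ i12; have x23 := hξ i23
    have y01 := hy i01; have y12 := hy i12; have y23 := hy i23
    obtain ⟨a, b, c, d, hdet, hval, s01, s23⟩ := exists_moebius_match_aux ξ y hPQ
      (mul_pos (mul_pos (mul_pos (by linarith) (by linarith)) (by linarith))
        (mul_pos (mul_pos (by linarith) (by linarith)) (by linarith)))
      (mul_pos (by linarith) (by linarith)) (mul_pos (by linarith) (by linarith))
      (mul_pos_of_neg_of_neg (by linarith) (by linarith)) (mul_pos (by linarith) (by linarith))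
    exact ⟨a, b, c, d, hdet, moebius_intervals_of_match hdet hval s01 s23⟩

end Matching

end Literature.Probability.RandomPlanarGeometry

end
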